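import Summits.CriticalPhenomena.Ising3DConformalLimit.Theorems.ExistsScaleCovariantLimit.Negative.DyadicIdentity
import HarnessLib

/-!
# Tightness + triadic uniqueness ⟹ triadic pointwise convergence of the pinned zoom
(line `Sketch` of the crux `ExistsScaleCovariantLimit`, item stmt-CriticalPhenomena-1981;
stub `stub_triadicConvergence_of`, step S5)

Pure topology glue (the sub-subsequence argument). The pinned zoom of the critical `ℤ³` Ising
correlators is `k ↦ rescaledCorrelator (criticalCorr 3) rhoPin n ((3^k)⁻¹)` along the triadic meshes.
Assume

* TIGHTNESS: every mesh sequence `u k ∈ (0,1]`, `u → 0⁺`, has a subsequence along which the zoom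
  converges locally uniformly on `NonCoincident 3 n`, for all `n` simultaneously;
* UNIQUENESS within the triadic family: any two such limits along (strictly increasing) triadic
  subsequences agree off the diagonals.

Then the WHOLE triadic sequence converges pointwise off the diagonals (K2). Proof: tightness applied
to `(3^k)⁻¹` gives `φ₀, S₀`; by `Filter.tendsto_of_subseq_tendsto` it suffices that every subsequence
`ns → ∞` has a further subsequence along which the zoom at `x` tends to `S₀ n x`: refine `ns` to a
strictly increasing `ns ∘ φ'` (`Filter.strictMono_subseq_of_tendsto_atTop`), re-apply tightness along
it to get `φ₁, S₁`, identify `S₁ n x = S₀ n x` by triadic uniqueness (both are limits along strictly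
increasing triadic subsequences), and evaluate the locally uniform convergence at `x`
(`TendstoLocallyUniformlyOn.tendsto_at`).

Sequential `atTop` companion of `ExistsScaleCovariantLimitNegative.pinnedLimit_iff_tight_and_unique`
(direction `⇐`) and of the dyadic glue `stub_dyadicConvergence_of` (S4). No named facts. [folklore]
-/

noncomputable section

namespace Summit.CriticalPhenomena.Ising3DConformalLimit.Cruxes.ExistsScaleCovariantLimit.TwoHierarchies

open Literature.Probability.LatticeModels Filter Set
open scoped Topology
open Summit.CriticalPhenomena.Ising3DConformalLimit.MoebiusLimitExistsOnlyInteraction (rhoPin)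

/-- `3^{-k} ∈ (0,1]` (bookkeeping, as `Dyadic.dyad_mem` with `2 ↦ 3`). [folklore] -/
private theorem triad_mem (k : ℕ) : ((3:ℝ) ^ k)⁻¹ ∈ Set.Ioc (0:ℝ) 1 :=
  ⟨by positivity, inv_le_one_of_one_le₀ (one_le_pow₀ (by norm_num : (1:ℝ) ≤ 3))⟩

/-- `3^{-k} → 0⁺` (bookkeeping, as `Dyadic.tendsto_dyad` with `2 ↦ 3`). [folklore] -/
private theorem tendsto_triad' : Tendsto (fun k : ℕ => ((3:ℝ) ^ k)⁻¹) atTop (𝓝[>] (0:ℝ)) := by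
  refine tendsto_nhdsWithin_iff.2 ⟨?_, Filter.Eventually.of_forall fun k => (triad_mem k).1⟩
  exact tendsto_inv_atTop_zero.comp (tendsto_pow_atTop_atTop_of_one_lt (by norm_num : (1:ℝ) < 3))

/-- **S5 — glue: tightness of the pinned zoom + triadic uniqueness ⟹ K2** (pointwise convergence of
`k ↦ rescaledCorrelator (criticalCorr 3) rhoPin n ((3^k)⁻¹) x` at every `x ∈ NonCoincident 3 n`, all
`n`). Sub-subsequence argument (`Filter.tendsto_of_subseq_tendsto`): every subsequence of the triadic
meshes has, by tightness, a locally uniformly convergent sub-subsequence, whose limit is, by triadic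
uniqueness, the candidate limit `S₀` obtained from tightness along the full triadic sequence. [folklore] -/
theorem stub_triadicConvergence_of :
    (∀ u : ℕ → ℝ, (∀ k, u k ∈ Set.Ioc (0:ℝ) 1) → Tendsto u atTop (𝓝[>] (0:ℝ)) →
      ∃ φ : ℕ → ℕ, StrictMono φ ∧ ∃ S : CorrFamily 3, ∀ n,
        TendstoLocallyUniformlyOn (fun k => rescaledCorrelator (criticalCorr 3) rhoPin n (u (φ k)))
          (S n) atTop (NonCoincident 3 n)) →
    (∀ (φ ψ : ℕ → ℕ) (S S' : CorrFamily 3), StrictMono φ → StrictMono ψ →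
      (∀ n : ℕ, TendstoLocallyUniformlyOn
        (fun j : ℕ => rescaledCorrelator (criticalCorr 3) rhoPin n (((3:ℝ) ^ (φ j))⁻¹)) (S n) atTop
        (NonCoincident 3 n)) →
      (∀ n : ℕ, TendstoLocallyUniformlyOn
        (fun j : ℕ => rescaledCorrelator (criticalCorr 3) rhoPin n (((3:ℝ) ^ (ψ j))⁻¹)) (S' n) atTop
        (NonCoincident 3 n)) →
      ∀ n : ℕ, ∀ x ∈ NonCoincident 3 n, S n x = S' n x) →
    ∃ S : CorrFamily 3, ∀ n : ℕ, ∀ x ∈ NonCoincident 3 n,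
      Tendsto (fun k : ℕ => rescaledCorrelator (criticalCorr 3) rhoPin n (((3:ℝ) ^ k)⁻¹) x) atTop
        (𝓝 (S n x)) := by
  intro htight huniq
  -- tightness along the full triadic sequence: a candidate limit `S₀` along `φ₀`
  obtain ⟨φ₀, hφ₀, S₀, h₀⟩ := htight (fun k : ℕ => ((3:ℝ) ^ k)⁻¹) triad_mem tendsto_triad'
  refine ⟨S₀, fun n x hx => ?_⟩
  -- every subsequence `ns → ∞` has a further subsequence along which the zoom at `x` tends to `S₀ n x`
  refine Filter.tendsto_of_subseq_tendsto fun ns hns => ?_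
  -- refine `ns` to a strictly increasing subsequence `ns ∘ φ'`
  obtain ⟨φ', -, hmono⟩ := Filter.strictMono_subseq_of_tendsto_atTop hns
  -- tightness along `ns ∘ φ'`: a sub-subsequence `(ns ∘ φ') ∘ φ₁` with limit `S₁`
  obtain ⟨φ₁, hφ₁, S₁, h₁⟩ := htight (fun j : ℕ => ((3:ℝ) ^ (ns (φ' j)))⁻¹)
    (fun j => triad_mem (ns (φ' j))) (tendsto_triad'.comp hmono.tendsto_atTop)
  -- triadic uniqueness: `S₁ n x = S₀ n x`
  have hEq : S₁ n x = S₀ n x :=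
    huniq (fun j : ℕ => ns (φ' (φ₁ j))) φ₀ S₁ S₀ (hmono.comp hφ₁) hφ₀ h₁ h₀ n x hx
  refine ⟨fun j : ℕ => φ' (φ₁ j), ?_⟩
  rw [← hEq]
  exact (h₁ n).tendsto_at hx

end Summit.CriticalPhenomena.Ising3DConformalLimit.Cruxes.ExistsScaleCovariantLimit.TwoHierarchies

end
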